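import Mathlib
import Literature.Analysis.FluidPDE.VectorCalculus
import Literature.Analysis.FluidPDE.SwirlTransportProofs

/-!
# Route `FilamentSkeletonRss` · crux `TransverseReductionRJ` (stmt-NavierStokesRegularity-21221) — line `kelvin_gate`,
# stub S2 `PolynomialKelvinGate`: the ROTATION DIRECTION is an exact kernel vector of the linearised profile operator
# (the typed "rate-rigidity" risk §Rate of the line card, velocity part)

Helper file (theorems only, `--supports stmt-NavierStokesRegularity-21221 --as helper`).  HONEST FRAMING: bookkeeping
for a HYPOTHETICAL filament-type RSS blow-up route; nothing here bears on Navier–Stokes regularity, and nothing here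
proves or refutes the stub.

The rotating-Leray profile operator (velocity part, the crux's pointwise vocabulary)
`E_α(U)(y) = α (e₃ × U(y) − DU(y)[e₃ × y]) + ½ U(y) + ½ DU(y)[y] − ΔU(y) + DU(y)[U(y)]`
is equivariant under the rotations `R_θ` about `e₃` (`E_α(R_θ ∘ U ∘ R_θ⁻¹) = R_θ ∘ E_α(U) ∘ R_θ⁻¹`, landed for exact
solutions as `stub_profileRotationCovariance`).  This file proves the INFINITESIMAL form, which is what the linear
theory of stub S2 sees: writing `𝓡V (y) := e₃ × V(y) − DV(y)[e₃ × y]` for the infinitesimal rotation of a vector field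
(`𝓡V = d/dθ|₀ (R_θ ∘ V ∘ R_θ⁻¹)`), and `𝓛_(α,U) W = α 𝓡W + ½ W + ½ DW[y] − ΔW + DW[U] + DU[W]` for the linearisation
of `E_α` at `U` (the operator a Kelvin gate must invert modulo the accretion modes), one has for every `C³` field `U`

  `𝓛_(α,U) (𝓡U) (y) = 𝓡 (E_α U) (y)`   (`lerayLin_rotField_eq_rotField_lerayOp`).

Consequently, at an EXACT profile (`E_α(U) + ∇P = Σ_j B_j D_j`) the field `𝓡U` solves the linearised equation with
forcing `−𝓡(∇P) + Σ_j B_j 𝓡D_j`; with `𝓡(∇P) = ∇(−DP[e₃ × y])` (pressure part, not in this file) this exhibits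
`(𝓡U, −DP[e₃×y])` as a kernel vector of `(W, Q) ↦ 𝓛W + ∇Q` modulo `span{𝓡D_j}` — the obstruction count behind the
line card's §Rate (if the linearisation is Fredholm of index 0 on the gate's spaces, a cokernel direction must be
covered by `span{D_pj}`).  Only second- and third-order symmetry of derivatives and the skewness of `e₃ × ·` enter:
the drift, stretching and convective terms commute with `𝓡` by symmetry of `D²U`, the Laplacian by symmetry of `D³U`
plus `Σ_i D²U[e_i, e₃ × e_i] = 0`.
-/

set_option linter.dupNamespace false

noncomputable section

namespace Summit.NavierStokesRegularity.NavierStokesRegularity.Theorems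

open Set Function
open Literature.Analysis.FluidPDE
open scoped InnerProductSpace Laplacian ContDiff Topology

namespace KelvinGate

/-! ## Calculus helpers -/

/-- Derivative of `z ↦ c z v` for a differentiable operator-valued `c` and a fixed vector `v`:
`D(c · v)(x) h = c'(h) v`. -/
theorem hasFDerivAt_clm_apply_const {F : Type*} [NormedAddCommGroup F] [NormedSpace ℝ F]
    {c : EuclideanSpace ℝ (Fin 3) → EuclideanSpace ℝ (Fin 3) →L[ℝ] F}
    {c' : EuclideanSpace ℝ (Fin 3) →L[ℝ] EuclideanSpace ℝ (Fin 3) →L[ℝ] F} {x : EuclideanSpace ℝ (Fin 3)}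
    (hc : HasFDerivAt c c' x) (v : EuclideanSpace ℝ (Fin 3)) :
    HasFDerivAt (fun z => c z v) (c'.flip v) x := by
  simpa using hc.clm_apply (hasFDerivAt_const v x)

/-- The Laplacian of a `C²` map on `ℝ³` is the trace of the second derivative in the standard basis:
`Δf(x) = Σ_i D²f(x)[e_i, e_i]`. -/
theorem laplacian_eq_sum_fderiv_fderiv {F : Type*} [NormedAddCommGroup F] [NormedSpace ℝ F]
    (f : EuclideanSpace ℝ (Fin 3) → F) :
    Δ f = fun x => ∑ i : Fin 3, fderiv ℝ (fderiv ℝ f) x (EuclideanSpace.basisFun (Fin 3) ℝ i)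
      (EuclideanSpace.basisFun (Fin 3) ℝ i) := by
  rw [InnerProductSpace.laplacian_eq_iteratedFDeriv_orthonormalBasis f (EuclideanSpace.basisFun (Fin 3) ℝ)]
  simp only [iteratedFDeriv_two_apply, Matrix.cons_val_zero, Matrix.cons_val_one]

/-- `e₃ × e₀ = e₁`. -/
theorem rotGenL_basisFun_zero :
    rotGenL (EuclideanSpace.basisFun (Fin 3) ℝ 0) = EuclideanSpace.basisFun (Fin 3) ℝ 1 := by
  ext i; fin_cases i <;> simp [rotGen]

/-- `e₃ × e₁ = −e₀`. -/
theorem rotGenL_basisFun_one :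
    rotGenL (EuclideanSpace.basisFun (Fin 3) ℝ 1) = -EuclideanSpace.basisFun (Fin 3) ℝ 0 := by
  ext i; fin_cases i <;> simp [rotGen]

/-- `e₃ × e₂ = 0`. -/
theorem rotGenL_basisFun_two :
    rotGenL (EuclideanSpace.basisFun (Fin 3) ℝ 2) = 0 := by
  ext i; fin_cases i <;> simp [rotGen]

/-- The trace term `Σ_i B(e_i, e₃ × e_i)` vanishes for every SYMMETRIC bilinear `B` (skewness of `e₃ × ·`). -/
theorem sum_apply_rotGenL_basisFun_eq_zero {F : Type*} [NormedAddCommGroup F] [NormedSpace ℝ F]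
    (B : EuclideanSpace ℝ (Fin 3) →L[ℝ] EuclideanSpace ℝ (Fin 3) →L[ℝ] F) (hB : ∀ v w, B v w = B w v) :
    ∑ i : Fin 3, B (EuclideanSpace.basisFun (Fin 3) ℝ i) (rotGenL (EuclideanSpace.basisFun (Fin 3) ℝ i)) = 0 := by
  simp only [Fin.sum_univ_three, rotGenL_basisFun_zero, rotGenL_basisFun_one, rotGenL_basisFun_two, map_neg,
    map_zero, add_zero, hB (EuclideanSpace.basisFun (Fin 3) ℝ 1) (EuclideanSpace.basisFun (Fin 3) ℝ 0)]
  abel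

/-- The crux's rotation field `e₃ × v` is the bundled generator `rotGenL v`. -/
theorem cross_single_two_eq_rotGenL (v : EuclideanSpace ℝ (Fin 3)) :
    cross (EuclideanSpace.single 2 1) v = rotGenL v := by
  ext i
  fin_cases i <;> simp [cross, rotGen, crossProduct]

/-! ## The Laplacian commutes with the infinitesimal rotation -/


/-- **`Δ(𝓡U) = 𝓡(ΔU)`** for every `C³` field `U` on `ℝ³`, where `𝓡V (y) = e₃ × V(y) − DV(y)[e₃ × y]` is the
infinitesimal rotation of a vector field about `e₃`: the Laplacian commutes with `V ↦ e₃ × V` (a constant linear map)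
and with the Lie derivative along the linear rotation field `y ↦ e₃ × y` up to the trace term
`2 Σ_i D²U[e_i, e₃ × e_i]`, which vanishes because `D²U(y)` is symmetric and `e₃ × ·` is skew; the remaining
third-order terms agree by the symmetry of `D³U(y)`. -/
theorem laplacian_rotField_eq (U : EuclideanSpace ℝ (Fin 3) → EuclideanSpace ℝ (Fin 3)) (hU : ContDiff ℝ 3 U)
    (y : EuclideanSpace ℝ (Fin 3)) :
    (Δ (fun z => cross (EuclideanSpace.single 2 1) (U z) - fderiv ℝ U z (cross (EuclideanSpace.single 2 1) z))) y =
      cross (EuclideanSpace.single 2 1) ((Δ U) y) - fderiv ℝ (Δ U) y (cross (EuclideanSpace.single 2 1) y) := by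
  -- Notation: `J = rotGenL`, `P = DU`, `Q = D²U`, `T = D³U` (curried Fréchet derivatives), `b` the standard basis.
  simp only [cross_single_two_eq_rotGenL]
  set J : EuclideanSpace ℝ (Fin 3) →L[ℝ] EuclideanSpace ℝ (Fin 3) := rotGenL with hJ
  set P := fderiv ℝ U with hP
  set Q := fderiv ℝ P with hQ
  set T := fderiv ℝ Q with hT
  set b := EuclideanSpace.basisFun (Fin 3) ℝ with hb
  -- regularity
  have hPc : ContDiff ℝ 2 P := hU.fderiv_right (by norm_num)
  have hQc : ContDiff ℝ 1 Q := hPc.fderiv_right (by norm_num)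
  have hUd : ∀ z, HasFDerivAt U (P z) z := fun z => (hU.differentiable (by norm_num) z).hasFDerivAt
  have hPd : ∀ z, HasFDerivAt P (Q z) z := fun z => (hPc.differentiable (by norm_num) z).hasFDerivAt
  have hQd : ∀ z, HasFDerivAt Q (T z) z := fun z => (hQc.differentiable (by norm_num) z).hasFDerivAt
  have hJd : ∀ z : EuclideanSpace ℝ (Fin 3), HasFDerivAt (fun w => J w) J z := fun z => J.hasFDerivAt
  -- symmetries of `Q = D²U` and `T = D³U`
  have symm2 : ∀ z v w, Q z v w = Q z w v := fun z v w =>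
    ((hU.contDiffAt (x := z)).isSymmSndFDerivAt
      (by rw [minSmoothness_of_isRCLikeNormedField]; norm_num)).eq v w
  have symm3a : ∀ v w, T y v w = T y w v := fun v w =>
    ((hPc.contDiffAt (x := y)).isSymmSndFDerivAt (by simp)).eq v w
  have symm3b : ∀ h v w, T y h v w = T y h w v := by
    intro h v w
    have e : (fun z => Q z v w) = fun z => Q z w v := funext fun z => symm2 z v w
    have d1 : HasFDerivAt (fun z => Q z v w) (((T y).flip v).flip w) y :=
      hasFDerivAt_clm_apply_const (hasFDerivAt_clm_apply_const (hQd y) v) w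
    have d2 : HasFDerivAt (fun z => Q z w v) (((T y).flip w).flip v) y :=
      hasFDerivAt_clm_apply_const (hasFDerivAt_clm_apply_const (hQd y) w) v
    rw [e] at d1
    have := congrArg (fun L => L h) (d1.unique d2)
    simpa only [ContinuousLinearMap.flip_apply] using this
  -- the Laplacian of `U` and its derivative
  have hΔU : Δ U = fun z => ∑ i : Fin 3, Q z (b i) (b i) := laplacian_eq_sum_fderiv_fderiv U
  have hΔUd : HasFDerivAt (fun z => ∑ i : Fin 3, Q z (b i) (b i))
      (∑ i : Fin 3, ((T y).flip (b i)).flip (b i)) y := by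
    have : ∀ i : Fin 3, HasFDerivAt (fun z => Q z (b i) (b i)) (((T y).flip (b i)).flip (b i)) y := fun i =>
      hasFDerivAt_clm_apply_const (hasFDerivAt_clm_apply_const (hQd y) (b i)) (b i)
    exact HasFDerivAt.fun_sum fun i _ => this i
  -- the rotation field `RU = J ∘ U − P · (J ·)`: first derivative, `C²` regularity
  have hRUd : ∀ z, HasFDerivAt (fun w => J (U w) - P w (J w))
      (J.comp (P z) - ((P z).comp J + (Q z).flip (J z))) z := fun z =>
    (J.hasFDerivAt.comp z (hUd z)).sub ((hPd z).clm_apply (hJd z))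
  have hRU : fderiv ℝ (fun w => J (U w) - P w (J w)) = fun z => J.comp (P z) - ((P z).comp J + (Q z).flip (J z)) :=
    funext fun z => (hRUd z).fderiv
  have hRUc : ContDiff ℝ 2 (fun w => J (U w) - P w (J w)) :=
    (J.contDiff.comp (hU.of_le (by norm_num))).sub (hPc.clm_apply J.contDiff)
  have hDRUdiff : ∀ z, DifferentiableAt ℝ (fderiv ℝ (fun w => J (U w) - P w (J w))) z := fun z =>
    (hRUc.fderiv_right (m := 1) (by norm_num)).differentiable (by norm_num) z
  -- second derivative of `RU` in the direction pair `(b i, b i)`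
  have hD2RU : ∀ i : Fin 3, fderiv ℝ (fderiv ℝ (fun w => J (U w) - P w (J w))) y (b i) (b i) =
      J (Q y (b i) (b i)) - (Q y (b i) (J (b i)) + (T y (b i) (b i) (J y) + Q y (b i) (J (b i)))) := by
    intro i
    have step1 : fderiv ℝ (fderiv ℝ (fun w => J (U w) - P w (J w))) y (b i) (b i) =
        fderiv ℝ (fun z => fderiv ℝ (fun w => J (U w) - P w (J w)) z (b i)) y (b i) := by
      rw [(hasFDerivAt_clm_apply_const (hDRUdiff y).hasFDerivAt (b i)).fderiv, ContinuousLinearMap.flip_apply]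
    rw [step1, hRU]
    have h1 : HasFDerivAt (fun z => J (P z (b i))) (J.comp ((Q y).flip (b i))) y :=
      J.hasFDerivAt.comp y (hasFDerivAt_clm_apply_const (hPd y) (b i))
    have h2 : HasFDerivAt (fun z => P z (J (b i))) ((Q y).flip (J (b i))) y :=
      hasFDerivAt_clm_apply_const (hPd y) (J (b i))
    have h3 : HasFDerivAt (fun z => Q z (b i) (J z)) ((Q y (b i)).comp J + ((T y).flip (b i)).flip (J y)) y :=
      (hasFDerivAt_clm_apply_const (hQd y) (b i)).clm_apply (hJd y)
    have h123 : HasFDerivAt (fun z => J (P z (b i)) - (P z (J (b i)) + Q z (b i) (J z)))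
        (J.comp ((Q y).flip (b i)) - ((Q y).flip (J (b i)) + ((Q y (b i)).comp J + ((T y).flip (b i)).flip (J y)))) y :=
      h1.fun_sub (h2.fun_add h3)
    have hfun : (fun z => (J.comp (P z) - ((P z).comp J + (Q z).flip (J z))) (b i)) =
        fun z => J (P z (b i)) - (P z (J (b i)) + Q z (b i) (J z)) := by
      funext z
      simp only [_root_.sub_apply, _root_.add_apply, ContinuousLinearMap.comp_apply, ContinuousLinearMap.flip_apply]
    rw [hfun, h123.fderiv]
    simp only [_root_.sub_apply, _root_.add_apply, ContinuousLinearMap.comp_apply, ContinuousLinearMap.flip_apply]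
    abel
  -- assemble: `Δ(RU) y = J (ΔU y) − Σ_i T y bᵢ bᵢ (J y)` and `D(ΔU) y (J y) = Σ_i T y (J y) bᵢ bᵢ`
  have h0 : ∑ i : Fin 3, Q y (b i) (J (b i)) = 0 := sum_apply_rotGenL_basisFun_eq_zero (Q y) (symm2 y)
  have e3 : ∑ i : Fin 3, T y (J y) (b i) (b i) = ∑ i : Fin 3, T y (b i) (b i) (J y) := by
    refine Finset.sum_congr rfl fun i _ => ?_
    rw [symm3a (J y) (b i), symm3b (b i) (J y) (b i)]
  rw [hΔU, hΔUd.fderiv, laplacian_eq_sum_fderiv_fderiv]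
  simp only [← hb, hD2RU, Finset.sum_sub_distrib, Finset.sum_add_distrib, map_sum, h0,
    FunLike.coe_sum, Finset.sum_apply, ContinuousLinearMap.flip_apply, e3.symm]
  abel

/-! ## The rotation direction is a kernel vector of the linearisation -/


/-- **`𝓛_(α,U)(𝓡U) = 𝓡(E_α U)` — the infinitesimal rotation of a `C³` field is mapped by the linearised profile
operator to the infinitesimal rotation of the profile operator.**  Here `e₃ × v = cross (EuclideanSpace.single 2 1) v`,
`𝓡V (y) = e₃ × V(y) − DV(y)[e₃ × y]`,
`E_α(U)(y) = α 𝓡U(y) + ½ U(y) + ½ DU(y)[y] − ΔU(y) + DU(y)[U(y)]`,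
`𝓛_(α,U) W (y) = α 𝓡W(y) + ½ W(y) + ½ DW(y)[y] − ΔW(y) + DW(y)[U(y)] + DU(y)[W(y)]`, all written out; the left side
is VERBATIM the line's `lerayLin α U (𝓡U) y` and the argument of `𝓡` on the right is VERBATIM `lerayOp α U`.
The drift, stretching and convective terms commute with `𝓡` by the symmetry of `D²U(y)`, the Laplacian by
`laplacian_rotField_eq`.  In particular at an exact profile `E_α(U) + ∇P = Σ_j B_j D_j` the rotation direction `𝓡U`
solves `𝓛 (𝓡U) = −𝓡(∇P) + Σ_j B_j 𝓡 D_j` (the typed §Rate risk of stub S2). -/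
theorem lerayLin_rotField_eq_rotField_lerayOp (α : ℝ)
    (U : EuclideanSpace ℝ (Fin 3) → EuclideanSpace ℝ (Fin 3)) (hU : ContDiff ℝ 3 U) (y : EuclideanSpace ℝ (Fin 3)) :
    α • (cross (EuclideanSpace.single 2 1)
            ((fun z => cross (EuclideanSpace.single 2 1) (U z) - fderiv ℝ U z (cross (EuclideanSpace.single 2 1) z)) y) -
          fderiv ℝ (fun z => cross (EuclideanSpace.single 2 1) (U z) - fderiv ℝ U z (cross (EuclideanSpace.single 2 1) z)) y
            (cross (EuclideanSpace.single 2 1) y)) +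
        (1/2:ℝ) • (fun z => cross (EuclideanSpace.single 2 1) (U z) - fderiv ℝ U z (cross (EuclideanSpace.single 2 1) z)) y +
        (1/2:ℝ) • fderiv ℝ (fun z => cross (EuclideanSpace.single 2 1) (U z) -
            fderiv ℝ U z (cross (EuclideanSpace.single 2 1) z)) y y -
        (Δ (fun z => cross (EuclideanSpace.single 2 1) (U z) - fderiv ℝ U z (cross (EuclideanSpace.single 2 1) z))) y +
        fderiv ℝ (fun z => cross (EuclideanSpace.single 2 1) (U z) - fderiv ℝ U z (cross (EuclideanSpace.single 2 1) z)) y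
          (U y) +
        fderiv ℝ U y
          ((fun z => cross (EuclideanSpace.single 2 1) (U z) - fderiv ℝ U z (cross (EuclideanSpace.single 2 1) z)) y) =
      cross (EuclideanSpace.single 2 1)
          ((fun z => α • (cross (EuclideanSpace.single 2 1) (U z) - fderiv ℝ U z (cross (EuclideanSpace.single 2 1) z)) +
            (1/2:ℝ) • U z + (1/2:ℝ) • fderiv ℝ U z z - (Δ U) z + fderiv ℝ U z (U z)) y) -
        fderiv ℝ (fun z => α • (cross (EuclideanSpace.single 2 1) (U z) - fderiv ℝ U z (cross (EuclideanSpace.single 2 1) z)) +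
            (1/2:ℝ) • U z + (1/2:ℝ) • fderiv ℝ U z z - (Δ U) z + fderiv ℝ U z (U z)) y
          (cross (EuclideanSpace.single 2 1) y) := by
  -- the Laplacian term, before renaming
  have hΔRU := laplacian_rotField_eq U hU y
  -- Notation: `J = rotGenL`, `P = DU`, `Q = D²U`.
  simp only [cross_single_two_eq_rotGenL] at hΔRU ⊢
  set J : EuclideanSpace ℝ (Fin 3) →L[ℝ] EuclideanSpace ℝ (Fin 3) := rotGenL with hJ
  set P := fderiv ℝ U with hP
  set Q := fderiv ℝ P with hQ
  -- regularity
  have hPc : ContDiff ℝ 2 P := hU.fderiv_right (by norm_num)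
  have hUd : ∀ z, HasFDerivAt U (P z) z := fun z => (hU.differentiable (by norm_num) z).hasFDerivAt
  have hPd : ∀ z, HasFDerivAt P (Q z) z := fun z => (hPc.differentiable (by norm_num) z).hasFDerivAt
  have hJd : ∀ z : EuclideanSpace ℝ (Fin 3), HasFDerivAt (fun w => J w) J z := fun z => J.hasFDerivAt
  -- symmetry of `Q = D²U`
  have symm2 : ∀ z v w, Q z v w = Q z w v := fun z v w =>
    ((hU.contDiffAt (x := z)).isSymmSndFDerivAt
      (by rw [minSmoothness_of_isRCLikeNormedField]; norm_num)).eq v w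
  -- `ΔU` is differentiable (it is `z ↦ Σ_i Q z eᵢ eᵢ` with `Q ∈ C¹`)
  have hΔUdiff : HasFDerivAt (Δ U) (fderiv ℝ (Δ U) y) y := by
    refine DifferentiableAt.hasFDerivAt ?_
    rw [laplacian_eq_sum_fderiv_fderiv]
    have hQc : ContDiff ℝ 1 Q := hPc.fderiv_right (by norm_num)
    have hQd : HasFDerivAt Q (fderiv ℝ Q y) y := (hQc.differentiable (by norm_num) y).hasFDerivAt
    exact (HasFDerivAt.fun_sum fun i _ => hasFDerivAt_clm_apply_const (hasFDerivAt_clm_apply_const hQd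
      (EuclideanSpace.basisFun (Fin 3) ℝ i)) (EuclideanSpace.basisFun (Fin 3) ℝ i)).differentiableAt
  -- the rotation field `RU = J ∘ U − P · (J ·)` and its derivative
  have hRUd : ∀ z, HasFDerivAt (fun w => J (U w) - P w (J w))
      (J.comp (P z) - ((P z).comp J + (Q z).flip (J z))) z := fun z =>
    (J.hasFDerivAt.comp z (hUd z)).sub ((hPd z).clm_apply (hJd z))
  have hRU : fderiv ℝ (fun w => J (U w) - P w (J w)) = fun z => J.comp (P z) - ((P z).comp J + (Q z).flip (J z)) :=
    funext fun z => (hRUd z).fderiv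
  -- derivative of the full profile operator `EU`
  have hEUd : HasFDerivAt (fun z => α • (J (U z) - P z (J z)) + (1/2:ℝ) • U z + (1/2:ℝ) • P z z - (Δ U) z + P z (U z))
      (α • (J.comp (P y) - ((P y).comp J + (Q y).flip (J y))) + (1/2:ℝ) • P y +
        (1/2:ℝ) • ((P y).comp (ContinuousLinearMap.id ℝ _) + (Q y).flip y) -
        fderiv ℝ (Δ U) y + ((P y).comp (P y) + (Q y).flip (U y))) y :=
    ((((hRUd y).const_smul α).add ((hUd y).const_smul (1/2:ℝ))).add
      (((hPd y).clm_apply ((ContinuousLinearMap.id ℝ _).hasFDerivAt)).const_smul (1/2:ℝ))).sub hΔUdiff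
      |>.add ((hPd y).clm_apply (hUd y))
  -- assemble
  rw [hRU, hΔRU, hEUd.fderiv]
  simp only [_root_.sub_apply, _root_.add_apply, ContinuousLinearMap.comp_apply,
    ContinuousLinearMap.flip_apply, _root_.smul_apply, ContinuousLinearMap.coe_id', id,
    map_add, map_sub, map_smul, smul_add, smul_sub]
  -- use the symmetry of `D²U`
  have e1 : Q y (J y) y = Q y y (J y) := symm2 y _ _
  have e2 : Q y (J y) (U y) = Q y (U y) (J y) := symm2 y _ _
  rw [e1, e2]
  module

end KelvinGate

end Summit.NavierStokesRegularity.NavierStokesRegularity.Theorems
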